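/-
Copyright (c) 2026 the pub-hodgecm-mathlib formalisation cell (harness21).  Prover seat hodgecm-mathlib-F0P3a-p08 (g18): road «S3-tree» ROUTE (A) «SHALIKA» (LEAD F0P3a-plan
(g12), architect A-p16 (g30) ruling A-98 (1)), organ ‹RANK› — the U(3) instantiation, FIELD HALF; 2026-09-01.
-/
import Literature.NumberTheory.Automorphic.UnitaryThreeTransvectionClassValuation   -- ★ p846322 (this lineage): `sq_ne_exp_neg_one_mul_sq`, `v_norm_eq_sq`, `conj_cornerUnipotent_sub_one_mul_self`; brings ★ `UnitaryThreeUnipotentConjugacy`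
import Literature.NumberTheory.Automorphic.IntMatrixLevelConjugation                 -- (this seat, FILE 0): level bookkeeping under `GL_N(𝒪)`-conjugation ∕ deep left translation; brings ★ `UnitaryThreeLevelTwoCongruence` (`IsIntMatrix` API, `isIntMatrix_upperUnipotent`), ★ `UnitaryThreeRegularUnipotentClass` (ONE regular class), `UnramifiedLocalConjDatum`
import HarnessLib

/-!
# The unipotent classes of `U(3)` over an UNRAMIFIED quadratic extension of a local field: the entry formula of a transvection conjugate, the parity of its
# integral conjugates, and the four classes `1`, `[n(ϖδ)]`, `[n(δ)]`, regular (Rogawski 1990 §3.9)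

Topic `NumberTheory/Automorphic`; namespace `Literature.NumberTheory.Automorphic.UnitaryGroup`.  THEOREMS ONLY (no definition, no instance, no notation, no named fact,
no `sorry`); kernel lane.  Cell `pub/hodgecm-mathlib` (D-0151), crux H413 = `stmt-HodgeConjecture-24833`; road «S3-tree» ROUTE (A) «SHALIKA» (architect A-p16 (g29∕g30)
A-84 (2) ∕ A-87 (1) ∕ A-98 (1); END F0P3a-p03 (g15) contract v5 `stub_rankCM`), organ ‹RANK› «orbit separation at level 2»: this is the FIELD half of the U(3)
instantiation of ★ `det_classOrbitalIntegral_indicator_ne_zero` (p846366) — everything about the group `U(σ, J₀)(K) ≤ GL₃(K)` of the split form `J₀ = antidiag(1,1,1)`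
over a valued field `K` with an involution `σ` preserving the valuation that the CM file needs, so that the CM file is transport only.

THE MATHEMATICS ([Rogawski1990, §3.9]; `n(t) = 1 + t·E₀₂`, `σt = −t`, is the singular unipotent; its `U(σ,J₀)`-class is `t mod N(K^×)` — ★ p845022).
(§1) THE ENTRY FORMULA: for `k ∈ U(σ, J₀)` the last row of `k⁻¹ = J₀ ᵗσ(k) J₀` is `σ` of the first column of `k` reversed, `(k⁻¹)_{2j} = σ(k_{rev j, 0})`, hence
`(k·n(t)·k⁻¹ − 1)_{ij} = t · k_{i0} · σ(k_{rev j, 0})`.  (§2) PARITY OF INTEGRAL CONJUGATES: the valuations of these nine entries are `|t|·|k_{i0}|·|k_{i′0}|`, maximal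
`|t|·M²` (`M = max_i |k_{i0}| ≠ 0`); so if `k n(t) k⁻¹ − 1` is INTEGRAL with some entry a UNIT then `|t|·M² = 1`, impossible for `|t| = exp(−1)` (★ `sq_ne_exp_neg_one_mul_sq`):
**an integral conjugate of `n(t)`, `|t| = |ϖ|`, is `≡ 1 (mod 𝔪)`** — the transvection class of ODD invariant misses `K ∖ K(1)`.  (§3) NORMAL FORMS: under «every
`σ`-fixed UNIT is a norm `z·σz`» (unramified) and a `σ`-fixed uniformiser `ϖ`, `n(t) ∼ n(t′)` whenever `t, t′ ∈ E⁰ ∖ 0` have `|t′| = |t|·exp(2m)`; every `t ∈ E⁰ ∖ 0`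
is `N(z)`-equivalent to one of valuation `1` or `exp(−1)`.  (§4) THE FOUR CLASSES: a unipotent `g ∈ U(σ, J₀)` (`(g − 1)³ = 0`) is `1`, or conjugate to `n₁ = n(ϖδ)`, or to
`n₀ = n(δ)` (`δ` a `σ`-skew unit), or REGULAR (`(g − 1)² ≠ 0`, one class by ★ Prop. 3.9.1); the four cases are mutually exclusive (`n₁ ≁ n₀` by parity).  (§5) INTEGRAL
REPRESENTATIVES AND THEIR LEVELS: `n₁ ≡ 1 (mod 𝔪)`, `≢ 1 (mod 𝔪²)`; `n₀` integral, `≢ 1 (mod 𝔪)`; `u_reg = u(1, −t₀)` (`t₀ + σt₀ = 1` integral) is an integral regular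
unipotent of `U(σ, J₀)` with `((u_reg − 1)²)_{02} = −1` a unit.
HONEST LABEL: HC_CM is proved only modulo the 2 remaining named inputs (hLiu418 24832, h413 24833) until rung 0 closes; nothing printed is asserted here (elementary
matrix algebra over a valued field with involution); `stub_N6nsS3id` stays a print row until the road's END lands.

* §1 `inv_apply_eq_of_mem_unitaryGroupOfForm` (`k⁻¹ = J₀ ᵗσ(k) J₀`), `inv_apply_two_eq_of_mem_unitaryGroupOfForm`, **`conj_cornerUnipotent_sub_one_apply`**, `exists_apply_zero_ne_zero`.
* §2 `exists_forall_v_apply_zero_le`, `isIntMatrix_inv_of_mem_unitaryGroupOfForm`, `v_conj_cornerUnipotent_sub_one_apply`, **`v_conj_cornerUnipotent_sub_one_apply_lt_one`**.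
* §3 `exists_conj_cornerUnipotent_of_v_eq_mul_exp` (same parity ⇒ conjugate).  §4 **`sq_zero_unipotent_cases`** (`1`, `[n(ϖδ)]`, `[n(δ)]`).
* §5 `coe_cornerUnipotent_sub_one`, `forall_v_cornerUnipotent_sub_one_apply_le_iff`, `isIntMatrix_cornerUnipotent`, **`forall_v_conj_cornerUnipotent_sub_one_apply_le_exp_neg_one`**,
  **`upperUnipotentOne_facts`**, `not_forall_v_upperUnipotentOne_sub_one_sq_apply_le`, `exists_units_coe_eq_cornerUnipotent'`.

## References
* [Rogawski1990] J. D. Rogawski, *Automorphic Representations of Unitary Groups in Three Variables*, Ann. of Math. Stud. 123 (1990), §3.9 p. 32 (Prop. 3.9.1), §1.10 p. 9,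
  §8.1 p. 112.
* [Serre1979] J.-P. Serre, *Local Fields*, GTM 67 (1979), Ch. V §2 Prop. 3 and Cor. (`U_F = N U_E` for an unramified extension).
-/

set_option autoImplicit false

open scoped Matrix MatrixGroups Valued WithZero
open Matrix

namespace Literature.NumberTheory.Automorphic.UnitaryGroup

open Literature.NumberTheory.Automorphic.HermitianLattice Literature.NumberTheory.Automorphic.UnitaryLatticeTree

/-! ## §1 The entry formula of a transvection conjugate -/

section EntryFormula

variable {K : Type*} [Field K] (σ : K →+* K)

/-- **The inverse of `k ∈ U(σ, J₀)` is `J₀ ᵗσ(k) J₀`**, entrywise: `(k⁻¹)_{ij} = σ(k_{rev j, rev i})` — `(k⁻¹ y)_i = B₀(e_{rev i}, k⁻¹ y) = B₀(k e_{rev i}, y)` by unitarity.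
[cite: Rogawski1990, §1.10 p. 9] -/
theorem inv_apply_eq_of_mem_unitaryGroupOfForm {k : GL (Fin 3) K} (hk : k ∈ unitaryGroupOfForm σ ((StdForm.antidiagonal 3).over K)) (i j : Fin 3) :
    ((k⁻¹ : GL (Fin 3) K) : Matrix (Fin 3) (Fin 3) K) i j = σ ((k : Matrix (Fin 3) (Fin 3) K) (Fin.rev j) (Fin.rev i)) := by
  have hinv := (mem_unitaryGroupOfForm_antidiagonal_iff (σ := σ) (N := 3) k).1 hk
  have hkk : (k : Matrix (Fin 3) (Fin 3) K) * ((k⁻¹ : GL (Fin 3) K) : Matrix (Fin 3) (Fin 3) K) = 1 := by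
    rw [← Units.val_mul, mul_inv_cancel, Units.val_one]
  have h1 : ((k⁻¹ : GL (Fin 3) K) : Matrix (Fin 3) (Fin 3) K) i j = (((k⁻¹ : GL (Fin 3) K) : Matrix (Fin 3) (Fin 3) K).mulVec (Pi.single j 1)) i := by
    rw [Matrix.mulVec_single_one]; rfl
  have h2 : (((k⁻¹ : GL (Fin 3) K) : Matrix (Fin 3) (Fin 3) K).mulVec (Pi.single j 1)) i =
      B₀ σ 3 (Pi.single (Fin.rev i) 1) (((k⁻¹ : GL (Fin 3) K) : Matrix (Fin 3) (Fin 3) K).mulVec (Pi.single j 1)) := by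
    rw [B₀_single_left, Fin.rev_rev]
  have h3 : B₀ σ 3 (Pi.single (Fin.rev i) 1) (((k⁻¹ : GL (Fin 3) K) : Matrix (Fin 3) (Fin 3) K).mulVec (Pi.single j 1)) =
      B₀ σ 3 ((k : Matrix (Fin 3) (Fin 3) K).mulVec (Pi.single (Fin.rev i) 1)) (Pi.single j 1) := by
    conv_rhs => rw [← Matrix.one_mulVec (Pi.single (M := fun _ : Fin 3 => K) j (1 : K)), ← hkk, ← Matrix.mulVec_mulVec]
    rw [hinv]
  rw [h1, h2, h3, B₀_single_right, Matrix.mulVec_single_one]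
  rfl

/-- In particular the last row of `k⁻¹` is `σ` of the first column of `k`, reversed: `(k⁻¹)_{2j} = σ(k_{rev j, 0})`. [cite: Rogawski1990, §1.10 p. 9] -/
theorem inv_apply_two_eq_of_mem_unitaryGroupOfForm {k : GL (Fin 3) K} (hk : k ∈ unitaryGroupOfForm σ ((StdForm.antidiagonal 3).over K)) (j : Fin 3) :
    ((k⁻¹ : GL (Fin 3) K) : Matrix (Fin 3) (Fin 3) K) 2 j = σ ((k : Matrix (Fin 3) (Fin 3) K) (Fin.rev j) 0) :=
  inv_apply_eq_of_mem_unitaryGroupOfForm σ hk 2 j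

/-- **THE ENTRY FORMULA**: for `k ∈ U(σ, J₀)` and `u = n(t)`, `(k u k⁻¹ − 1)_{ij} = t · k_{i0} · σ(k_{rev j, 0})` (`k u k⁻¹ − 1 = k (t E₀₂) k⁻¹`, §1).
[cite: Rogawski1990, §3.9 p. 32] -/
theorem conj_cornerUnipotent_sub_one_apply {t : K} {u k : GL (Fin 3) K} (hu : (u : Matrix (Fin 3) (Fin 3) K) = !![1, 0, t; 0, 1, 0; 0, 0, 1])
    (hk : k ∈ unitaryGroupOfForm σ ((StdForm.antidiagonal 3).over K)) (i j : Fin 3) :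
    ((((k * u * k⁻¹ : GL (Fin 3) K) : Matrix (Fin 3) (Fin 3) K) - 1) i j) =
      t * (k : Matrix (Fin 3) (Fin 3) K) i 0 * σ ((k : Matrix (Fin 3) (Fin 3) K) (Fin.rev j) 0) := by
  have hkk : (k : Matrix (Fin 3) (Fin 3) K) * ((k⁻¹ : GL (Fin 3) K) : Matrix (Fin 3) (Fin 3) K) = 1 := by
    rw [← Units.val_mul, mul_inv_cancel, Units.val_one]
  have hconj : (((k * u * k⁻¹ : GL (Fin 3) K) : Matrix (Fin 3) (Fin 3) K) - 1) =
      (k : Matrix (Fin 3) (Fin 3) K) * ((u : Matrix (Fin 3) (Fin 3) K) - 1) * ((k⁻¹ : GL (Fin 3) K) : Matrix (Fin 3) (Fin 3) K) := by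
    rw [Matrix.mul_sub, Matrix.sub_mul, Matrix.mul_one, hkk, Units.val_mul, Units.val_mul]
  have hu1 : (u : Matrix (Fin 3) (Fin 3) K) - 1 = !![0, 0, t; 0, 0, 0; 0, 0, 0] := by
    rw [hu]
    ext a b
    fin_cases a <;> fin_cases b <;> simp
  rw [← inv_apply_two_eq_of_mem_unitaryGroupOfForm σ hk j, hconj, hu1, Matrix.mul_assoc, Matrix.mul_apply, Fin.sum_univ_three]
  simp only [Matrix.mul_apply, Fin.sum_univ_three]
  fin_cases i <;> simp <;> ring

/-- The first column of an invertible matrix is non-zero: some `k_{i0} ≠ 0`. [cite: Rogawski1990, §1.10 p. 9] -/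
theorem exists_apply_zero_ne_zero (k : GL (Fin 3) K) : ∃ i, (k : Matrix (Fin 3) (Fin 3) K) i 0 ≠ 0 := by
  by_contra h
  push Not at h
  have hcol : (k : Matrix (Fin 3) (Fin 3) K).mulVec (Pi.single 0 1) = 0 := by
    rw [Matrix.mulVec_single_one]
    funext i
    exact h i
  have hkk : ((k⁻¹ : GL (Fin 3) K) : Matrix (Fin 3) (Fin 3) K) * (k : Matrix (Fin 3) (Fin 3) K) = 1 := by
    rw [← Units.val_mul, inv_mul_cancel, Units.val_one]
  have h0 : (Pi.single 0 1 : Fin 3 → K) = 0 := by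
    calc (Pi.single 0 1 : Fin 3 → K) = (((k⁻¹ : GL (Fin 3) K) : Matrix (Fin 3) (Fin 3) K) * (k : Matrix (Fin 3) (Fin 3) K)).mulVec (Pi.single 0 1) := by
          rw [hkk, Matrix.one_mulVec]
      _ = 0 := by rw [← Matrix.mulVec_mulVec, hcol, Matrix.mulVec_zero]
  have := congr_fun h0 0
  simp at this

end EntryFormula

/-! ## §2 The parity of integral transvection conjugates -/

section Parity

variable {K : Type*} [Field K] [Valued K ℤᵐ⁰] (σ : K →+* K)

/-- A maximal first-column valuation: some `i₀` with `|k_{i0}| ≤ |k_{i₀ 0}|` for all `i`, and `|k_{i₀ 0}| ≠ 0`. [cite: Rogawski1990, §1.10 p. 9] -/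
theorem exists_forall_v_apply_zero_le (k : GL (Fin 3) K) :
    ∃ i₀, (∀ i, Valued.v ((k : Matrix (Fin 3) (Fin 3) K) i 0) ≤ Valued.v ((k : Matrix (Fin 3) (Fin 3) K) i₀ 0)) ∧
      Valued.v ((k : Matrix (Fin 3) (Fin 3) K) i₀ 0) ≠ 0 := by
  obtain ⟨i₀, -, hi₀⟩ := Finset.exists_max_image Finset.univ (fun i => Valued.v ((k : Matrix (Fin 3) (Fin 3) K) i 0)) Finset.univ_nonempty
  obtain ⟨i₁, hi₁⟩ := exists_apply_zero_ne_zero k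
  refine ⟨i₀, fun i => hi₀ i (Finset.mem_univ i), fun h0 => hi₁ ?_⟩
  have hle := hi₀ i₁ (Finset.mem_univ i₁)
  rw [h0, le_zero_iff, Valuation.zero_iff] at hle
  exact hle

/-- **An integral element of `U(σ, J₀)` has integral inverse** (`σ` preserves `|·|`; `(k⁻¹)_{ij} = σ(k_{rev j, rev i})`) — so `U(σ, J₀) ∩ M₃(𝒪) = U(σ, J₀) ∩ GL₃(𝒪)`.
[cite: Tits1979, §3.5] -/
theorem isIntMatrix_inv_of_mem_unitaryGroupOfForm (hvσ : ∀ a, Valued.v (σ a) = Valued.v a) {k : GL (Fin 3) K}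
    (hk : k ∈ unitaryGroupOfForm σ ((StdForm.antidiagonal 3).over K)) (hint : IsIntMatrix (k : Matrix (Fin 3) (Fin 3) K)) :
    IsIntMatrix ((k⁻¹ : GL (Fin 3) K) : Matrix (Fin 3) (Fin 3) K) := fun i j => by
  rw [inv_apply_eq_of_mem_unitaryGroupOfForm σ hk, hvσ]
  exact hint _ _

/-- **The valuation of the entries of a transvection conjugate**: `|(k n(t) k⁻¹ − 1)_{ij}| = |t|·|k_{i0}|·|k_{rev j,0}|` (`σ` preserves `|·|`). [cite: Rogawski1990, §3.9 p. 32] -/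
theorem v_conj_cornerUnipotent_sub_one_apply (hvσ : ∀ a, Valued.v (σ a) = Valued.v a) {t : K} {u k : GL (Fin 3) K}
    (hu : (u : Matrix (Fin 3) (Fin 3) K) = !![1, 0, t; 0, 1, 0; 0, 0, 1]) (hk : k ∈ unitaryGroupOfForm σ ((StdForm.antidiagonal 3).over K)) (i j : Fin 3) :
    Valued.v ((((k * u * k⁻¹ : GL (Fin 3) K) : Matrix (Fin 3) (Fin 3) K) - 1) i j) =
      Valued.v t * Valued.v ((k : Matrix (Fin 3) (Fin 3) K) i 0) * Valued.v ((k : Matrix (Fin 3) (Fin 3) K) (Fin.rev j) 0) := by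
  rw [conj_cornerUnipotent_sub_one_apply σ hu hk, map_mul, map_mul, hvσ]

/-- **AN INTEGRAL CONJUGATE OF `n(t)`, `|t| = exp(−1)`, IS `≡ 1 (mod 𝔪)`**: if `k ∈ U(σ, J₀)` and every entry of `k n(t) k⁻¹ − 1` has valuation `≤ 1`, then every entry
has valuation `< 1`.  (Otherwise the maximal entry valuation `|t|·M²`, `M = max_i |k_{i0}|`, equals `1`, i.e. `M² = exp(1)·1²` — parity, ★ `sq_ne_exp_neg_one_mul_sq`.)
This is the vanishing «the transvection class of odd invariant misses `K ∖ K(1)`» of the RANK table. [cite: Rogawski1990, §3.9 p. 32; §8.1 p. 112] -/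
theorem v_conj_cornerUnipotent_sub_one_apply_lt_one (hvσ : ∀ a, Valued.v (σ a) = Valued.v a) {t : K} (ht : Valued.v t = WithZero.exp (-1 : ℤ))
    {u k : GL (Fin 3) K} (hu : (u : Matrix (Fin 3) (Fin 3) K) = !![1, 0, t; 0, 1, 0; 0, 0, 1]) (hk : k ∈ unitaryGroupOfForm σ ((StdForm.antidiagonal 3).over K))
    (hle : ∀ i j, Valued.v ((((k * u * k⁻¹ : GL (Fin 3) K) : Matrix (Fin 3) (Fin 3) K) - 1) i j) ≤ 1) (i j : Fin 3) :
    Valued.v ((((k * u * k⁻¹ : GL (Fin 3) K) : Matrix (Fin 3) (Fin 3) K) - 1) i j) < 1 := by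
  obtain ⟨i₀, hmax, hM0⟩ := exists_forall_v_apply_zero_le k
  set M := Valued.v ((k : Matrix (Fin 3) (Fin 3) K) i₀ 0) with hM
  -- the maximal entry `(i₀, rev i₀)` has valuation `|t|·M²`, which is `≤ 1` and `≠ 1`
  have htop : Valued.v ((((k * u * k⁻¹ : GL (Fin 3) K) : Matrix (Fin 3) (Fin 3) K) - 1) i₀ (Fin.rev i₀)) = Valued.v t * M * M := by
    rw [v_conj_cornerUnipotent_sub_one_apply σ hvσ hu hk, Fin.rev_rev]
  have hne : Valued.v t * M * M ≠ 1 := by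
    intro h1
    apply sq_ne_exp_neg_one_mul_sq (x := 1) hM0
    rw [one_pow, ← h1, ht, pow_two, mul_assoc]
  have hlt : Valued.v t * M * M < 1 := lt_of_le_of_ne (htop ▸ hle i₀ (Fin.rev i₀)) hne
  refine lt_of_le_of_lt ?_ hlt
  rw [v_conj_cornerUnipotent_sub_one_apply σ hvσ hu hk]
  exact mul_le_mul' (mul_le_mul' le_rfl (hmax i)) (hmax (Fin.rev j))

end Parity


/-! ## §3 Normal forms under «every `σ`-fixed unit is a norm» -/

section NormalForms

variable {K : Type*} [Field K] [Valued K ℤᵐ⁰] (σ : K →+* K) {ϖ : K}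

/-- **SAME PARITY ⇒ CONJUGATE** (unramified datum + «every `σ`-fixed UNIT is a norm `z·σz`»): for `t, t′ ∈ E⁰ ∖ 0` with `|t′| = |t|·exp(2m)`, `n(t) ∼ n(t′)` under
`U(σ, J₀)` — the `σ`-fixed unit `(t′∕t)·ϖ^{2m}` is a norm `zσz`, so `t′ = N(z ϖ^{−m})·t` and ★ `exists_conj_eq_iff_exists_norm_mul` applies.
[cite: Rogawski1990, §3.9 p. 32] [cite: Serre1979, Ch. V §2 Prop. 3] -/
theorem exists_conj_cornerUnipotent_of_v_eq_mul_exp (hd : UnramifiedLocalConjDatum σ ϖ)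
    (hnormU : ∀ x : K, σ x = x → Valued.v x = 1 → ∃ z : K, z * σ z = x)
    {t t' : K} (ht : t ≠ 0) (hσt : σ t = -t) (hσt' : σ t' = -t') (m : ℤ)
    (hv : Valued.v t' = Valued.v t * WithZero.exp (2 * m))
    {u u' : GL (Fin 3) K} (hu : (u : Matrix (Fin 3) (Fin 3) K) = !![1, 0, t; 0, 1, 0; 0, 0, 1])
    (hu' : (u' : Matrix (Fin 3) (Fin 3) K) = !![1, 0, t'; 0, 1, 0; 0, 0, 1]) :
    ∃ k : GL (Fin 3) K, k ∈ unitaryGroupOfForm σ ((StdForm.antidiagonal 3).over K) ∧ k * u * k⁻¹ = u' := by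
  have hϖ0 : ϖ ≠ 0 := hd.ϖ_ne_zero
  have hvt0 : Valued.v t ≠ 0 := (Valuation.ne_zero_iff _).2 ht
  -- the `σ`-fixed unit `x = (t′∕t)·ϖ^{2m}`
  set x : K := t' / t * ϖ ^ (2 * m) with hx
  have hσx : σ x = x := by rw [hx, map_mul, map_div₀, hσt, hσt', map_zpow₀, hd.σϖ, neg_div_neg_eq]
  have hvx : Valued.v x = 1 := by
    rw [hx, map_mul, map_div₀, map_zpow₀, hv, hd.vϖ, ← WithZero.exp_zsmul, smul_eq_mul, mul_div_cancel_left₀ _ hvt0, ← WithZero.exp_add,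
      ← WithZero.exp_zero]
    congr 1; ring
  obtain ⟨z, hz⟩ := hnormU x hσx hvx
  have hz0 : z ≠ 0 := by
    rintro rfl
    rw [zero_mul] at hz
    rw [← hz, map_zero] at hvx
    exact zero_ne_one hvx
  refine (exists_conj_eq_iff_exists_norm_mul σ hd.σσ ht hu hu').2 ⟨z * ϖ ^ (-m), mul_ne_zero hz0 (zpow_ne_zero _ hϖ0), ?_⟩
  rw [map_mul, map_zpow₀, hd.σϖ]
  symm
  calc z * ϖ ^ (-m) * (σ z * ϖ ^ (-m)) * t = (z * σ z) * (ϖ ^ (-m) * ϖ ^ (-m)) * t := by ring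
    _ = x * ϖ ^ (-(2 * m)) * t := by rw [hz, ← zpow_add₀ hϖ0]; congr 2; ring
    _ = t' := by rw [hx, mul_assoc (t' / t) (ϖ ^ (2 * m)), ← zpow_add₀ hϖ0, add_neg_cancel, zpow_zero, mul_one, div_mul_cancel₀ t' ht]

end NormalForms

/-! ## §4 The four unipotent classes -/

section FourClasses

variable {K : Type*} [Field K] [Valued K ℤᵐ⁰] (σ : K →+* K) {ϖ : K}

/-- **THE SINGULAR UNIPOTENT CLASSES AT AN UNRAMIFIED PLACE ARE `{1}`, `[n(ϖδ)]`, `[n(δ)]`** (`δ` a `σ`-skew UNIT): a square-zero unipotent `g ∈ U(σ, J₀)` is `1` or conjugate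
to `n₁ = n(ϖδ)` or to `n₀ = n(δ)`.  (★ `exists_conj_coe_eq_cornerUnipotent_of_sq_eq_zero` gives `n(t)`, `σt = −t`; `|t| = exp(n)` with `n` odd ∕ even is the parity of §3.)
Together with ★ `exists_conj_eq_of_regular_unipotent` (ONE regular class) these are the four unipotent classes of [Rogawski1990, §3.9].
[cite: Rogawski1990, §3.9 p. 32, Prop. 3.9.1] [cite: Serre1979, Ch. V §2 Prop. 3] -/
theorem sq_zero_unipotent_cases (hd : UnramifiedLocalConjDatum σ ϖ)
    (hnormU : ∀ x : K, σ x = x → Valued.v x = 1 → ∃ z : K, z * σ z = x)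
    {δ : K} (hσδ : σ δ = -δ) (hvδ : Valued.v δ = 1)
    {n₀ n₁ : GL (Fin 3) K} (hn₀ : (n₀ : Matrix (Fin 3) (Fin 3) K) = !![1, 0, δ; 0, 1, 0; 0, 0, 1])
    (hn₁ : (n₁ : Matrix (Fin 3) (Fin 3) K) = !![1, 0, ϖ * δ; 0, 1, 0; 0, 0, 1])
    {g : GL (Fin 3) K} (hg : g ∈ unitaryGroupOfForm σ ((StdForm.antidiagonal 3).over K))
    (hsq : ((g : Matrix (Fin 3) (Fin 3) K) - 1) * ((g : Matrix (Fin 3) (Fin 3) K) - 1) = 0) :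
    g = 1 ∨ (∃ k : GL (Fin 3) K, k ∈ unitaryGroupOfForm σ ((StdForm.antidiagonal 3).over K) ∧ k * g * k⁻¹ = n₁) ∨
      (∃ k : GL (Fin 3) K, k ∈ unitaryGroupOfForm σ ((StdForm.antidiagonal 3).over K) ∧ k * g * k⁻¹ = n₀) := by
  obtain ⟨k, hk, t, hσt, hshape⟩ := exists_conj_coe_eq_cornerUnipotent_of_sq_eq_zero σ hd.σσ hg hsq
  by_cases ht : t = 0
  · left
    have h1 : k * g * k⁻¹ = 1 := Units.ext (by rw [hshape, ht, Units.val_one]; ext i j; fin_cases i <;> fin_cases j <;> rfl)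
    calc g = k⁻¹ * (k * g * k⁻¹) * k := by group
      _ = 1 := by rw [h1, mul_one, inv_mul_cancel]
  · right
    have hσt' : σ t = -t := eq_neg_of_add_eq_zero_left hσt
    have hvt0 : Valued.v t ≠ 0 := (Valuation.ne_zero_iff _).2 ht
    obtain ⟨n, hn⟩ : ∃ n : ℤ, Valued.v t = WithZero.exp n := ⟨WithZero.log (Valued.v t), (WithZero.exp_log hvt0).symm⟩
    rcases Int.even_or_odd n with ⟨a, ha⟩ | ⟨a, ha⟩
    · -- even invariant: conjugate to `n(δ)`
      right
      obtain ⟨k', hk', hconj⟩ := exists_conj_cornerUnipotent_of_v_eq_mul_exp σ hd hnormU ht hσt' hσδ (-a)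
        (by rw [hvδ, hn, ← WithZero.exp_add, ← WithZero.exp_zero]; congr 1; omega) hshape hn₀
      exact ⟨k' * k, mul_mem hk' hk, by rw [← hconj]; group⟩
    · -- odd invariant: conjugate to `n(ϖδ)`
      left
      have hσ1 : σ (ϖ * δ) = -(ϖ * δ) := by rw [map_mul, hd.σϖ, hσδ, mul_neg]
      obtain ⟨k', hk', hconj⟩ := exists_conj_cornerUnipotent_of_v_eq_mul_exp σ hd hnormU ht hσt' hσ1 (-a - 1)
        (by rw [map_mul, hd.vϖ, hvδ, mul_one, hn, ← WithZero.exp_add]; congr 1; omega) hshape hn₁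
      exact ⟨k' * k, mul_mem hk' hk, by rw [← hconj]; group⟩

end FourClasses

/-! ## §5 Integral representatives and their levels -/

section Representatives

variable {K : Type*} [Field K] [Valued K ℤᵐ⁰] (σ : K →+* K)

omit [Valued K ℤᵐ⁰] in
/-- `n(t) − 1 = t·E₀₂`. [cite: Rogawski1990, §1.10 p. 9] -/
theorem coe_cornerUnipotent_sub_one {t : K} {u : GL (Fin 3) K} (hu : (u : Matrix (Fin 3) (Fin 3) K) = !![1, 0, t; 0, 1, 0; 0, 0, 1]) :
    (u : Matrix (Fin 3) (Fin 3) K) - 1 = !![0, 0, t; 0, 0, 0; 0, 0, 0] := by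
  rw [hu]
  ext a b
  fin_cases a <;> fin_cases b <;> simp

/-- **The level of `n(t)`**: every entry of `n(t) − 1` has valuation `≤ c` iff `|t| ≤ c`. [cite: Rogawski1990, §1.10 p. 9] -/
theorem forall_v_cornerUnipotent_sub_one_apply_le_iff {t : K} {u : GL (Fin 3) K} (hu : (u : Matrix (Fin 3) (Fin 3) K) = !![1, 0, t; 0, 1, 0; 0, 0, 1])
    (c : ℤᵐ⁰) : (∀ a b, Valued.v (((u : Matrix (Fin 3) (Fin 3) K) - 1) a b) ≤ c) ↔ Valued.v t ≤ c := by
  rw [coe_cornerUnipotent_sub_one hu]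
  constructor
  · intro h; simpa using h 0 2
  · intro h a b
    fin_cases a <;> fin_cases b <;> simp [h]

/-- `n(t)` is integral for integral `t`. [cite: Tits1979, §3.3.3] -/
theorem isIntMatrix_cornerUnipotent {t : K} (ht : Valued.v t ≤ 1) {u : GL (Fin 3) K} (hu : (u : Matrix (Fin 3) (Fin 3) K) = !![1, 0, t; 0, 1, 0; 0, 0, 1]) :
    IsIntMatrix (u : Matrix (Fin 3) (Fin 3) K) := by
  rw [hu]
  exact isIntMatrix_upperUnipotent (by rw [map_zero]; exact zero_le_one) ht (by rw [map_zero]; exact zero_le_one)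

/-- **AN INTEGRAL CONJUGATE OF `n(t)`, `|t| = exp(−1)`, HAS LEVEL `≥ 1`** (§2 in the level currency): all entries of `k n(t) k⁻¹ − 1` are `≤ exp(−1)`.
[cite: Rogawski1990, §3.9 p. 32; §8.1 p. 112] -/
theorem forall_v_conj_cornerUnipotent_sub_one_apply_le_exp_neg_one (hvσ : ∀ a, Valued.v (σ a) = Valued.v a) {t : K}
    (ht : Valued.v t = WithZero.exp (-1 : ℤ)) {u k : GL (Fin 3) K} (hu : (u : Matrix (Fin 3) (Fin 3) K) = !![1, 0, t; 0, 1, 0; 0, 0, 1])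
    (hk : k ∈ unitaryGroupOfForm σ ((StdForm.antidiagonal 3).over K)) (hint : IsIntMatrix ((k * u * k⁻¹ : GL (Fin 3) K) : Matrix (Fin 3) (Fin 3) K))
    (a b : Fin 3) : Valued.v ((((k * u * k⁻¹ : GL (Fin 3) K) : Matrix (Fin 3) (Fin 3) K) - 1) a b) ≤ WithZero.exp (-1 : ℤ) :=
  (v_lt_one_iff _).1 (v_conj_cornerUnipotent_sub_one_apply_lt_one σ hvσ ht hu hk (isIntMatrix_sub hint isIntMatrix_one) a b)

/-- **The integral regular unipotent `u_reg = u(1, −t₀)`** (`t₀ + σt₀ = 1`, `|t₀| ≤ 1`, `σ` an involution): `u_reg ∈ U(σ, J₀)`, `u_reg` is integral,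
`(u_reg − 1)² = −E₀₂` (so `(u_reg − 1)² ≠ 0` and its `(0,2)` entry is a UNIT) and `(u_reg − 1)³ = 0`. [cite: Rogawski1990, §3.9 p. 32; §1.10 p. 9] -/
theorem upperUnipotentOne_facts (hσ : ∀ z : K, σ (σ z) = z) {t₀ : K} (ht₀ : Valued.v t₀ ≤ 1) (htr : t₀ + σ t₀ = 1) {u : GL (Fin 3) K}
    (hu : (u : Matrix (Fin 3) (Fin 3) K) = !![1, 1, -t₀; 0, 1, -1; 0, 0, 1]) :
    u ∈ unitaryGroupOfForm σ ((StdForm.antidiagonal 3).over K) ∧ IsIntMatrix (u : Matrix (Fin 3) (Fin 3) K) ∧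
      ((u : Matrix (Fin 3) (Fin 3) K) - 1) * ((u : Matrix (Fin 3) (Fin 3) K) - 1) = !![0, 0, -1; 0, 0, 0; 0, 0, 0] ∧
      ((u : Matrix (Fin 3) (Fin 3) K) - 1) * ((u : Matrix (Fin 3) (Fin 3) K) - 1) ≠ 0 ∧
      IsNilpotent ((u : Matrix (Fin 3) (Fin 3) K) - 1) := by
  have hmem : u ∈ unitaryGroupOfForm σ ((StdForm.antidiagonal 3).over K) := by
    refine (mem_unitaryGroupOfForm_iff_of_coe_eq_upperUnipotent σ hσ hu).2 ⟨by rw [map_one], ?_⟩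
    rw [map_neg, map_one, mul_one]
    linear_combination (-1 : K) * htr
  have hsq : ((u : Matrix (Fin 3) (Fin 3) K) - 1) * ((u : Matrix (Fin 3) (Fin 3) K) - 1) = !![0, 0, -1; 0, 0, 0; 0, 0, 0] := by
    rw [hu, upperUnipotent_sub_one_mul_self, one_mul]
  refine ⟨hmem, ?_, hsq, ?_, ⟨3, ?_⟩⟩
  · rw [hu]
    exact isIntMatrix_upperUnipotent (by rw [map_one]) (by rw [Valuation.map_neg]; exact ht₀) (by rw [Valuation.map_neg, map_one])
  · rw [hsq]
    intro h
    have h02 := congr_fun (congr_fun h 0) 2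
    simp at h02
  · rw [pow_succ, pow_two, hsq, hu]
    ext a b
    fin_cases a <;> fin_cases b <;> simp [Matrix.mul_apply, Fin.sum_univ_three]

/-- The `(0,2)` entry of `(u_reg − 1)²` is a unit, so `(u_reg − 1)²` is NOT `≡ 0 (mod 𝔪)`: `u_reg` is residually regular. [cite: Rogawski1990, §3.9 p. 32] -/
theorem not_forall_v_upperUnipotentOne_sub_one_sq_apply_le {t₀ : K} {u : GL (Fin 3) K} (hu : (u : Matrix (Fin 3) (Fin 3) K) = !![1, 1, -t₀; 0, 1, -1; 0, 0, 1])
    {c : ℤᵐ⁰} (hc : c < 1) : ¬ ∀ a b, Valued.v ((((u : Matrix (Fin 3) (Fin 3) K) - 1) * ((u : Matrix (Fin 3) (Fin 3) K) - 1)) a b) ≤ c := by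
  intro h
  have h02 := h 0 2
  rw [hu, upperUnipotent_sub_one_mul_self, one_mul] at h02
  simp at h02
  exact not_lt.2 h02 hc

omit [Valued K ℤᵐ⁰] in
/-- Units of `M₃(K)` with the matrix of `n(t)`, `d`-free: existence (★ `exists_units_coe_eq_cornerUnipotent`) restated with the inverse suppressed.
[cite: Rogawski1990, §1.10 p. 9] -/
theorem exists_units_coe_eq_cornerUnipotent' (t : K) : ∃ u : GL (Fin 3) K, (u : Matrix (Fin 3) (Fin 3) K) = !![1, 0, t; 0, 1, 0; 0, 0, 1] :=
  let ⟨u, hu, _⟩ := exists_units_coe_eq_cornerUnipotent t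
  ⟨u, hu⟩

end Representatives

end Literature.NumberTheory.Automorphic.UnitaryGroup
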